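import Literature.MathematicalPhysics.QuantumFieldTheory.Balaban1983to89.B9Thm33G0DirXHolderAtPinsSmooth
import Literature.MathematicalPhysics.QuantumFieldTheory.Balaban1983to89.B9MultiscaleSmoothPartitionYNear
import Literature.MathematicalPhysics.QuantumFieldTheory.Balaban1983to89.B9BackgroundsKLevelV1R

/-!
# `Balaban1983to89.B9Thm33G0DirXHolderAtPinsSmoothMembers` — [B9] Theorems 3.12–3.13 (pp. 421–426): THE W-c FACE `Thm33G0DirX.pXdDH` AT THE SMOOTH-PARTITION PIN
# `bH13 := weightNorm (bHZ 1 p) (Lʲη)⁻¹`, AT node00-def-Y's MEMBERS — over `bg9Y (M_N ℂ) SU(N) x` (today's certificate editions) and over the class-parametric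
# carrier `bg9YR (M_N ℂ) SU(N) R₁ R₂ x` (road (α1)); the enlargement radius DISCHARGED (`r := rNear d ℓ + 1`, `B9MultiscaleSmoothPartitionYNear`)

T. Bałaban, *Propagators for lattice gauge theories in a background field*, Commun. Math. Phys. **99** (1985) 389–434
[`Balaban1985BackgroundPropagators`, "B9"]; [4] = T. Bałaban, *Propagators and renormalization transformations for lattice gauge
theories. II*, Commun. Math. Phys. **96** (1984) 223–250 [`Balaban1984PropagatorsII`].

statement-level skeleton of published theorems with citation tags; proofs where landed; nothing here is a claim about the Yang–Mills
mass gap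

THE PRINTED LOCI.  (3.45) p. 398; (3.35)–(3.36) p. 396 (*"U with values in G"*, the small-field classes); (3.43) p. 398; (3.3) p. 390; pp. 421–423; [4] (2.2) p. 224,
(2.51)–(2.56) pp. 232–233, Lemma 2.1 (2.60)–(2.61) p. 234.

THE POINT (cell `pub-ymgap`, node N06, width seat `pub-ymgap-dag-n06-w6` g3).  `B9Thm33G0DirXHolderAtPinsSmooth` states the W-c face at the smooth source class at a
k-level index for ANY background; THIS FILE presses it at the N06 certificate's members `x : MemberY …` (geometry `geo9Y x = geo9K x.toKIdx`, basis `trBasis N`, reading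
`cfg := fun U => U`), discharging the contracting-links binder from «`U` is `SU(N)`-valued» (`SU(N) ≤ U1`) and the radius binder from `hβ1` alone
(`dist_sIK_le_of_nearY`: `NearY y z → d(y, sIK bI z) ≤ rNear d ℓ + 1`):
* ★★★ `pXdDH_pins_smooth_of_h45` (over `bg9Y (M_N ℂ) SU(N) x`, `U ∈ Reg335`) ∕ ★★★ `pXdDH_pinsR_smooth_of_h45` (over `bg9YR (M_N ℂ) SU(N) R₁ R₂ x`, `(hG : MemOfFam SU(N) R₁)`,
  `U ∈ (bg9YR …).Reg335 c α₀`): from a DISPLAYED (3.45) schema for `Φ β∘Dd ν∘G0∘Dds μ` read at `bHZK x.toKIdx 1 p` (what an edition would display in place of `hXd`: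
  print's (3.45) for G₀ verbatim at the smooth class), the kinematic pins `hDv ∕ hDds` and the small-gauge binder `hΘ` at exponent 1:
  `∀ ν β, 0 ≤ β → β < 1 → HasMaj (weightNorm (bHZ x.toKIdx 1 p) (Lʲη)⁻¹) (cNormR R₀ H₀ blkPX _ (β − 1)) ((Φ β ∘ₗ Dd ν ∘ₗ G0) ∘ₗ Dv) (BdX β·e^{−δ₃d})`,
  `BdX β ≥ (d+1)·((1 + C_Lip d ℓ)·(BZ β·L₀)·((cR39 (trBasis N)·CJZ ℓ p ϑ·e^{δ_J·rZ d ℓ (rNear d ℓ + 1)})·L₀)·c)`;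
* ★★ `pXdDH_pins_smoothGauge` ∕ ★★ `pXdDH_pinsR_smoothGauge`: the same from the certificate's DERIVED `Thm33G0Dir 𝔬 𝔭 Dd Dds R₀ H₀ bHX …` when its input family reads the
  smooth class at exponent 1 (`hbHX1 : bHX 1 = bHZK x.toKIdx 1 p`), `BZ β := Bi2 (1−β) β` — i.e. the displayed `hXd` of edition 39 (l.166) as a THEOREM once rows 19 are
  read at `bHXA x 1 = bHZK x.toKIdx 1 p` and `bH13 x := weightNorm (bHZ x.toKIdx 1 p) (Lʲη)⁻¹`.
HONEST SCOPE.  Kernel bookkeeping (one application of the k-level theorem per member); the (3.45)-type members, [4] Lemma 2.1 (`RowSum`), `Facts347` and the gauge binder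
`hΘ` (GAUGE-VARIANT for flat classes) are HYPOTHESES; nothing of [B9] or [4] asserted; COUNT-NEUTRAL; `hXd` NOT discharged until an edition pins; N06 NOT discharged;
one finite lattice at a time; nothing continuum, nothing about the mass gap ∕ Clay.  Cell `pub-ymgap` (HUMAN RULING D-0062 ∕ D-0154), Track A node N06 [B9], W-c face
`hXd`, width seat `pub-ymgap-dag-n06-w6` (g3), 2026-08-28.  NEW file; nothing landed is modified.
-/

noncomputable section

namespace Literature.MathematicalPhysics.QuantumFieldTheory.Balaban1983to89.B9Thm33G0DirXHolderAtPinsSmoothMembers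

open Node00 B6KLevelCensusIndexV1 B9BackgroundsKLevelV1
open B11SectG (HasMaj BlockNorm RowSum)
open B9SectDSup (weightNorm)
open B9Thm34Ext (toB6)
open B9Thm312Whole (GeoOK Ops)
open B9Thm312WholeClasses (cNormR)
open B9Thm312WholeDir (Thm33G0Dir)
open B9RWSums343Holder (HolderProbes)
open B9RWSums343to347Whole (Facts347)
open B9GeoNormsKLevelV1 (geo9K)
open B9CoReadingCoords (XBK coordOpK cdsBₗ)
open B9CoReadingCoordsS (XSK sIK)
open B9CoReadingCoordsTranspose (TrIdx trBasis)
open B9PinMembersKLevelV1 (MemberY geo9Y bg9Y)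
open B9BackgroundsKLevelV1R (RegFamY bg9YR MemOfFam mem_of_reg335R)
open B7Prop2SpecialUnitary (specialUnitaryUnits specialUnitaryUnits_le_U1)
open Node00.OpsYSectDCoords (DvcoKH)
open B9GradViaDivLettersAtPins (cfg_norm_le_one_of_reg335)
open B9GradViaDivLettersSmoothTerms (CJZ rZ)
open B9Thm39ReadingCoords (cR39)
open B9MultiscaleSmoothPartitionY (NearY)
open B9MultiscaleSmoothPartitionYLip (CLip)
open B9MultiscaleSmoothPartitionYNear (rNear dist_sIK_le_of_nearY)
open B9SmoothHolderClassS (bHZ)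
open B9SmoothHolderClassK (bHZK)
open B9Thm33G0DirXHolderAtPinsSmooth (pXdDH_smooth_of_h45 pXdDH_smooth_of_thm33G0Dir)
open B6GlobalChartV1 (PV blkV1)
open B6Geom246MultiLevelTorus (geomT)
open scoped Matrix.Norms.L2Operator

variable {d ℓ : ℕ} {hd : 1 ≤ d + 1} {hL : Odd (ℓ + 1) ∧ 1 < ℓ + 1} {b₀ b₁ : ℝ}
variable {Mstar : ℕ} {N : ℕ} [NeZero N]
variable [∀ x : MemberY d ℓ hd hL b₀ b₁ Mstar, Fintype (geo9Y x).Site]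

/-! ## §1 ★★★ From a displayed (3.45) schema read at the smooth bond class -/

/-- ★★★ **`hXd` AT THE SMOOTH PIN FROM THE (3.45) MEMBERS, EVERY MEMBER, EVERY `U ∈ Reg335` IN SMALL-GAUGE POSITION** (over `bg9Y (M_N ℂ) SU(N) x`): for probes `Φ β`
with anchors `blkPX`, operators `G0`, `Dd ν` and the kinematic letters pinned by `hDv : Dv = DvcoKH …` ∕ `hDds`, IF print's (3.45) members hold from `bHZK x.toKIdx 1 p`
(`h45`, constants `BZ β`), THEN `∀ ν β, 0 ≤ β → β < 1 → HasMaj (weightNorm (bHZ x.toKIdx 1 p) (Lʲη)⁻¹) (cNormR R₀ H₀ blkPX _ (β − 1)) ((Φ β ∘ₗ Dd ν ∘ₗ G0) ∘ₗ Dv)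
(BdX β·e^{−δ₃d})`, `BdX β ≥ (d+1)·((1 + C_Lip d ℓ)·(BZ β·L₀)·((cR39 (trBasis N)·CJZ ℓ p ϑ·e^{δ_J·rZ d ℓ (rNear d ℓ + 1)})·L₀)·c)`; `U ∈ Reg335` gives contracting links
(`cfg_norm_le_one_of_reg335`), `hβ1` gives the radius.
[cite: Balaban1985BackgroundPropagators, Thm 3.3 (3.45) p.398 + (3.35) p.396 + (3.43) p.398 + (3.3) p.390 + pp.421–423; Balaban1984PropagatorsII, (2.2) p.224 + (2.51)–(2.56) pp.232–233 + Lemma 2.1 (2.60)–(2.61) p.234] -/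
theorem pXdDH_pins_smooth_of_h45 (x : MemberY d ℓ hd hL b₀ b₁ Mstar) {bI : FBondY x.toKIdx → IBondY x.toKIdx}
    (hβ1 : ∀ f : FBondY x.toKIdx, (geomT x.D).dist (B6Ineq2142KLevelV1.β x.hN x.D x.hk (bI f)) (blkV1 x.hN x.D f) ≤ 1)
    (hbI0 : ∀ f : FBondY x.toKIdx, bI f = bI ⟨f.src, 0⟩) {c35 α₀ : ℝ}
    {U : (bg9Y (Matrix (Fin N) (Fin N) ℂ) (specialUnitaryUnits (Fin N)) x).Cfg}
    (hU : (bg9Y (Matrix (Fin N) (Fin N) ℂ) (specialUnitaryUnits (Fin N)) x).Reg335 c35 α₀ U) {ϑ : ℝ} (hϑ : 0 ≤ ϑ)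
    (hΘ : ∀ (μ : Fin (d + 1)) (s s' : Site (PV d ℓ x.toKIdx.m x.toKIdx.K hd hL) 0), Adm x.toKIdx ⟨s, μ⟩ ⟨s', μ⟩ →
      tpar x.toKIdx ⟨s, μ⟩ ⟨s', μ⟩ ^ (-(1 : ℝ)) * ‖(U μ s : Matrix (Fin N) (Fin N) ℂ) - (U μ s' : Matrix (Fin N) (Fin N) ℂ)‖ ≤ ϑ)
    {p : ℝ} (h1p : 1 ≤ p)
    {R₀ : ℝ} {H₀ : Prop} (hG : GeoOK (geo9Y x)) {σ c : ℝ} (hrow : RowSum (toB6 (geo9Y x) R₀ H₀) σ c)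
    {dF : ℕ} {δF α L₀ : ℝ} (hF : Facts347 (geo9Y x) R₀ H₀ dF δF α L₀) {PX : Type} [Fintype PX] {blkPX : PX → (geo9Y x).Site}
    {Φ : ℝ → ((XBK (TrIdx N) x.toKIdx → ℝ) →ₗ[ℝ] (PX → ℝ))} {G0 : Module.End ℝ (XBK (TrIdx N) x.toKIdx → ℝ)}
    {Dd Dds : Fin (d + 1) → Module.End ℝ (XBK (TrIdx N) x.toKIdx → ℝ)} {Dv : (XSK (TrIdx N) x.toKIdx → ℝ) →ₗ[ℝ] (XBK (TrIdx N) x.toKIdx → ℝ)}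
    (hDv : Dv = DvcoKH x.toKIdx (trBasis N) (bg9Y (Matrix (Fin N) (Fin N) ℂ) (specialUnitaryUnits (Fin N)) x) (fun U => U) U)
    (hDds : Dds = fun μ => coordOpK (trBasis N) (fun _ : Fin (d + 1) => cdsBₗ x.toKIdx U μ))
    {BZ : ℝ → ℝ} {δ₀ δJ δ₃ : ℝ} {BdX : ℝ → ℝ}
    (hBZ : ∀ β, 0 ≤ β → β < 1 → 0 ≤ BZ β) (hc : 0 ≤ c) (hδJ : 0 ≤ δJ)
    (hδ₃ : 0 ≤ δ₃) (hδ₃0 : δ₃ ≤ δ₀ - α * δF) (hδ₃J : δ₃ + σ ≤ δJ - α * δF)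
    (hBdX : ∀ β, 0 ≤ β → β < 1 →
      ((d : ℝ) + 1) * ((1 + CLip d ℓ) * (BZ β * L₀) * ((cR39 (trBasis N) * CJZ ℓ p ϑ * Real.exp (δJ * rZ d ℓ (rNear d ℓ + 1))) * L₀) * c) ≤ BdX β)
    (h45 : letI : Fintype (geo9K x.toKIdx).Site := (inferInstance : Fintype (geo9Y x).Site)
      ∀ (ν μ : Fin (d + 1)) (β : ℝ), 0 ≤ β → β < 1 →
        HasMaj (bHZK (κ := TrIdx N) x.toKIdx (R := R₀) (H := H₀) (zero_le_one : (0 : ℝ) ≤ 1) le_rfl h1p)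
          (BlockNorm.ofBlocks (toB6 (geo9Y x) R₀ H₀) blkPX) (Φ β ∘ₗ (Dd ν ∘ₗ (G0 ∘ₗ Dds μ)))
          (fun a a' => BZ β * (geo9Y x).len a ^ (-β) * Real.exp (-(δ₀ * (geo9Y x).dist a a')))) :
    letI : Fintype (geo9K x.toKIdx).Site := (inferInstance : Fintype (geo9Y x).Site)
    ∀ (ν : Fin (d + 1)) (β : ℝ), 0 ≤ β → β < 1 →
      HasMaj (weightNorm (bHZ (κ := TrIdx N) x.toKIdx (R := R₀) (H := H₀) (zero_le_one : (0 : ℝ) ≤ 1) le_rfl h1p)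
          (fun y => ((geo9Y x).len y)⁻¹) (fun y => inv_nonneg.mpr (hG.lenle y)))
        (cNormR R₀ H₀ blkPX hG.lenle (β - 1)) ((Φ β ∘ₗ Dd ν ∘ₗ G0) ∘ₗ Dv)
        (fun a a' => BdX β * Real.exp (-(δ₃ * (geo9Y x).dist a a'))) := by
  letI : Fintype (geo9K x.toKIdx).Site := (inferInstance : Fintype (geo9Y x).Site)
  exact pXdDH_smooth_of_h45 x.toKIdx (trBasis N) (bg9Y (Matrix (Fin N) (Fin N) ℂ) (specialUnitaryUnits (Fin N)) x) (fun U => U) hβ1 hbI0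
    (cfg_norm_le_one_of_reg335 x hU) hϑ hΘ (fun _ _ h => dist_sIK_le_of_nearY x.toKIdx hβ1 h) h1p hG hrow hF hDv hDds hBZ hc hδJ hδ₃ hδ₃0 hδ₃J
    hBdX h45

/-- ★★★ **THE SAME OVER THE CLASS-PARAMETRIC CARRIER `bg9YR (M_N ℂ) SU(N) R₁ R₂ x`** (node00-def-Y's road (α1)): objects and the premise
`U ∈ (bg9YR … R₁ R₂ x).Reg335 c α₀` over the carrier whose regularity predicates are the parameters `R₁ x ∕ R₂ x`, under the single class axiom
`(hG : MemOfFam SU(N) R₁)` («`U` is `SU(N)`-valued», (3.35)) — contracting links by `specialUnitaryUnits_le_U1 ∘ mem_of_reg335R`; the `bg9Y` form is the reading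
`R₁ := regY335`, `R₂ := regY336`.
[cite: Balaban1985BackgroundPropagators, Thm 3.3 (3.45) p.398 + (3.35)–(3.36) p.396 + (3.43) p.398 + (3.3) p.390 + pp.421–423; Balaban1984PropagatorsII, (2.2) p.224 + (2.51)–(2.56) pp.232–233 + Lemma 2.1 (2.60)–(2.61) p.234] -/
theorem pXdDH_pinsR_smooth_of_h45 {R₁ R₂ : RegFamY d ℓ hd hL b₀ b₁ Mstar (Matrix (Fin N) (Fin N) ℂ)}
    (hGm : MemOfFam (specialUnitaryUnits (Fin N)) R₁) (x : MemberY d ℓ hd hL b₀ b₁ Mstar) {bI : FBondY x.toKIdx → IBondY x.toKIdx}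
    (hβ1 : ∀ f : FBondY x.toKIdx, (geomT x.D).dist (B6Ineq2142KLevelV1.β x.hN x.D x.hk (bI f)) (blkV1 x.hN x.D f) ≤ 1)
    (hbI0 : ∀ f : FBondY x.toKIdx, bI f = bI ⟨f.src, 0⟩) {c35 α₀ : ℝ}
    {U : (bg9YR (Matrix (Fin N) (Fin N) ℂ) (specialUnitaryUnits (Fin N)) R₁ R₂ x).Cfg}
    (hU : (bg9YR (Matrix (Fin N) (Fin N) ℂ) (specialUnitaryUnits (Fin N)) R₁ R₂ x).Reg335 c35 α₀ U) {ϑ : ℝ} (hϑ : 0 ≤ ϑ)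
    (hΘ : ∀ (μ : Fin (d + 1)) (s s' : Site (PV d ℓ x.toKIdx.m x.toKIdx.K hd hL) 0), Adm x.toKIdx ⟨s, μ⟩ ⟨s', μ⟩ →
      tpar x.toKIdx ⟨s, μ⟩ ⟨s', μ⟩ ^ (-(1 : ℝ)) * ‖(U μ s : Matrix (Fin N) (Fin N) ℂ) - (U μ s' : Matrix (Fin N) (Fin N) ℂ)‖ ≤ ϑ)
    {p : ℝ} (h1p : 1 ≤ p)
    {R₀ : ℝ} {H₀ : Prop} (hG : GeoOK (geo9Y x)) {σ c : ℝ} (hrow : RowSum (toB6 (geo9Y x) R₀ H₀) σ c)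
    {dF : ℕ} {δF α L₀ : ℝ} (hF : Facts347 (geo9Y x) R₀ H₀ dF δF α L₀) {PX : Type} [Fintype PX] {blkPX : PX → (geo9Y x).Site}
    {Φ : ℝ → ((XBK (TrIdx N) x.toKIdx → ℝ) →ₗ[ℝ] (PX → ℝ))} {G0 : Module.End ℝ (XBK (TrIdx N) x.toKIdx → ℝ)}
    {Dd Dds : Fin (d + 1) → Module.End ℝ (XBK (TrIdx N) x.toKIdx → ℝ)} {Dv : (XSK (TrIdx N) x.toKIdx → ℝ) →ₗ[ℝ] (XBK (TrIdx N) x.toKIdx → ℝ)}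
    (hDv : Dv = DvcoKH x.toKIdx (trBasis N) (bg9YR (Matrix (Fin N) (Fin N) ℂ) (specialUnitaryUnits (Fin N)) R₁ R₂ x) (fun U => U) U)
    (hDds : Dds = fun μ => coordOpK (trBasis N) (fun _ : Fin (d + 1) => cdsBₗ x.toKIdx U μ))
    {BZ : ℝ → ℝ} {δ₀ δJ δ₃ : ℝ} {BdX : ℝ → ℝ}
    (hBZ : ∀ β, 0 ≤ β → β < 1 → 0 ≤ BZ β) (hc : 0 ≤ c) (hδJ : 0 ≤ δJ)
    (hδ₃ : 0 ≤ δ₃) (hδ₃0 : δ₃ ≤ δ₀ - α * δF) (hδ₃J : δ₃ + σ ≤ δJ - α * δF)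
    (hBdX : ∀ β, 0 ≤ β → β < 1 →
      ((d : ℝ) + 1) * ((1 + CLip d ℓ) * (BZ β * L₀) * ((cR39 (trBasis N) * CJZ ℓ p ϑ * Real.exp (δJ * rZ d ℓ (rNear d ℓ + 1))) * L₀) * c) ≤ BdX β)
    (h45 : letI : Fintype (geo9K x.toKIdx).Site := (inferInstance : Fintype (geo9Y x).Site)
      ∀ (ν μ : Fin (d + 1)) (β : ℝ), 0 ≤ β → β < 1 →
        HasMaj (bHZK (κ := TrIdx N) x.toKIdx (R := R₀) (H := H₀) (zero_le_one : (0 : ℝ) ≤ 1) le_rfl h1p)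
          (BlockNorm.ofBlocks (toB6 (geo9Y x) R₀ H₀) blkPX) (Φ β ∘ₗ (Dd ν ∘ₗ (G0 ∘ₗ Dds μ)))
          (fun a a' => BZ β * (geo9Y x).len a ^ (-β) * Real.exp (-(δ₀ * (geo9Y x).dist a a')))) :
    letI : Fintype (geo9K x.toKIdx).Site := (inferInstance : Fintype (geo9Y x).Site)
    ∀ (ν : Fin (d + 1)) (β : ℝ), 0 ≤ β → β < 1 →
      HasMaj (weightNorm (bHZ (κ := TrIdx N) x.toKIdx (R := R₀) (H := H₀) (zero_le_one : (0 : ℝ) ≤ 1) le_rfl h1p)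
          (fun y => ((geo9Y x).len y)⁻¹) (fun y => inv_nonneg.mpr (hG.lenle y)))
        (cNormR R₀ H₀ blkPX hG.lenle (β - 1)) ((Φ β ∘ₗ Dd ν ∘ₗ G0) ∘ₗ Dv)
        (fun a a' => BdX β * Real.exp (-(δ₃ * (geo9Y x).dist a a'))) := by
  letI : Fintype (geo9K x.toKIdx).Site := (inferInstance : Fintype (geo9Y x).Site)
  exact pXdDH_smooth_of_h45 x.toKIdx (trBasis N) (bg9YR (Matrix (Fin N) (Fin N) ℂ) (specialUnitaryUnits (Fin N)) R₁ R₂ x) (fun U => U) hβ1 hbI0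
    (fun ν s => specialUnitaryUnits_le_U1 (mem_of_reg335R hGm x hU ν s)) hϑ hΘ (fun _ _ h => dist_sIK_le_of_nearY x.toKIdx hβ1 h) h1p hG hrow hF
    hDv hDds hBZ hc hδJ hδ₃ hδ₃0 hδ₃J hBdX h45

/-! ## §2 ★★ From the certificate's derived `Thm33G0Dir` (edition 39's `hXd`, at the smooth pin) -/

/-- ★★ **`hXd` AT THE SMOOTH PIN FROM THE DERIVED `Thm33G0Dir`, EVERY MEMBER, EVERY `U ∈ Reg335` IN SMALL-GAUGE POSITION** (over `bg9Y (M_N ℂ) SU(N) x`): with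
`bH13 x := weightNorm (bHZ x.toKIdx 1 p) (Lʲη)⁻¹` and the input family read at exponent 1 as `bHZK x.toKIdx 1 p` (`hbHX1`), the field
`∀ ν β, 0 ≤ β → β < 1 → HasMaj (bH13 x) (𝔠_P^{(β−1)}) ((𝔭.ΦX U β ∘ₗ Dd U ν ∘ₗ 𝔬.G0 U) ∘ₗ 𝔬.Dv U) (BdX β·e^{−δ₃d})` holds, from the certificate's derived `Thm33G0Dir`
(`h33`), the pins `hDv ∕ hDds`, `U ∈ Reg335` (⇒ contracting links), the small-gauge binder `hΘ` at exponent 1 and numerics; radius discharged.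
`BdX β ≥ (d+1)·((1 + C_Lip d ℓ)·(Bi2 (1−β) β·L₀)·((cR39 (trBasis N)·CJZ ℓ p ϑ·e^{δ_J·rZ d ℓ (rNear d ℓ + 1)})·L₀)·c)`.
[cite: Balaban1985BackgroundPropagators, Thm 3.3 (3.45) p.398 + (3.35) p.396 + (3.43) p.398 + (3.3) p.390 + pp.421–423; Balaban1984PropagatorsII, (2.2) p.224 + (2.51)–(2.56) pp.232–233 + Lemma 2.1 (2.60)–(2.61) p.234] -/
theorem pXdDH_pins_smoothGauge (x : MemberY d ℓ hd hL b₀ b₁ Mstar) {bI : FBondY x.toKIdx → IBondY x.toKIdx}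
    (hβ1 : ∀ f : FBondY x.toKIdx, (geomT x.D).dist (B6Ineq2142KLevelV1.β x.hN x.D x.hk (bI f)) (blkV1 x.hN x.D f) ≤ 1)
    (hbI0 : ∀ f : FBondY x.toKIdx, bI f = bI ⟨f.src, 0⟩) {c35 α₀ : ℝ}
    {U : (bg9Y (Matrix (Fin N) (Fin N) ℂ) (specialUnitaryUnits (Fin N)) x).Cfg}
    (hU : (bg9Y (Matrix (Fin N) (Fin N) ℂ) (specialUnitaryUnits (Fin N)) x).Reg335 c35 α₀ U) {ϑ : ℝ} (hϑ : 0 ≤ ϑ)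
    (hΘ : ∀ (μ : Fin (d + 1)) (s s' : Site (PV d ℓ x.toKIdx.m x.toKIdx.K hd hL) 0), Adm x.toKIdx ⟨s, μ⟩ ⟨s', μ⟩ →
      tpar x.toKIdx ⟨s, μ⟩ ⟨s', μ⟩ ^ (-(1 : ℝ)) * ‖(U μ s : Matrix (Fin N) (Fin N) ℂ) - (U μ s' : Matrix (Fin N) (Fin N) ℂ)‖ ≤ ϑ)
    {p : ℝ} (h1p : 1 ≤ p)
    {R₀ : ℝ} {H₀ : Prop} (hG : GeoOK (geo9Y x)) {σ c : ℝ} (hrow : RowSum (toB6 (geo9Y x) R₀ H₀) σ c)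
    {dF : ℕ} {δF α L₀ : ℝ} (hF : Facts347 (geo9Y x) R₀ H₀ dF δF α L₀) {Z PX PY : Type} [Fintype PX] [Fintype PY]
    {𝔬 : Ops (geo9Y x) (bg9Y (Matrix (Fin N) (Fin N) ℂ) (specialUnitaryUnits (Fin N)) x) (XBK (TrIdx N) x.toKIdx) (XBK (TrIdx N) x.toKIdx) Z
      (XSK (TrIdx N) x.toKIdx)}
    {𝔭 : HolderProbes (geo9Y x) (bg9Y (Matrix (Fin N) (Fin N) ℂ) (specialUnitaryUnits (Fin N)) x) (XBK (TrIdx N) x.toKIdx) (XBK (TrIdx N) x.toKIdx) PX PY}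
    {Dd Dds : (bg9Y (Matrix (Fin N) (Fin N) ℂ) (specialUnitaryUnits (Fin N)) x).Cfg → Fin (d + 1) → Module.End ℝ (XBK (TrIdx N) x.toKIdx → ℝ)}
    {bHX : ℝ → BlockNorm (toB6 (geo9Y x) R₀ H₀) (XBK (TrIdx N) x.toKIdx → ℝ)} {B₀ δ₀ : ℝ} {Bh Bi : ℝ → ℝ} {Bi2 : ℝ → ℝ → ℝ}
    (h33 : Thm33G0Dir 𝔬 𝔭 Dd Dds R₀ H₀ bHX B₀ Bh Bi Bi2 δ₀ U)
    (hbHX1 : bHX 1 = (letI : Fintype (geo9K x.toKIdx).Site := (inferInstance : Fintype (geo9Y x).Site)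
      bHZK (κ := TrIdx N) x.toKIdx (R := R₀) (H := H₀) (zero_le_one : (0 : ℝ) ≤ 1) le_rfl h1p))
    (hDv : 𝔬.Dv U = DvcoKH x.toKIdx (trBasis N) (bg9Y (Matrix (Fin N) (Fin N) ℂ) (specialUnitaryUnits (Fin N)) x) (fun U => U) U)
    (hDds : Dds U = fun μ => coordOpK (trBasis N) (fun _ : Fin (d + 1) => cdsBₗ x.toKIdx U μ))
    {δJ δ₃ : ℝ} {BdX : ℝ → ℝ}
    (hBi2 : ∀ e b', 0 < e → e ≤ 1 → 0 ≤ b' → b' < 1 → 0 ≤ Bi2 e b') (hc : 0 ≤ c) (hδJ : 0 ≤ δJ)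
    (hδ₃ : 0 ≤ δ₃) (hδ₃0 : δ₃ ≤ δ₀ - α * δF) (hδ₃J : δ₃ + σ ≤ δJ - α * δF)
    (hBdX : ∀ β, 0 ≤ β → β < 1 →
      ((d : ℝ) + 1) * ((1 + CLip d ℓ) * (Bi2 (1 - β) β * L₀) * ((cR39 (trBasis N) * CJZ ℓ p ϑ * Real.exp (δJ * rZ d ℓ (rNear d ℓ + 1))) * L₀) * c) ≤
        BdX β) :
    letI : Fintype (geo9K x.toKIdx).Site := (inferInstance : Fintype (geo9Y x).Site)
    ∀ (ν : Fin (d + 1)) (β : ℝ), 0 ≤ β → β < 1 →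
      HasMaj (weightNorm (bHZ (κ := TrIdx N) x.toKIdx (R := R₀) (H := H₀) (zero_le_one : (0 : ℝ) ≤ 1) le_rfl h1p)
          (fun y => ((geo9Y x).len y)⁻¹) (fun y => inv_nonneg.mpr (hG.lenle y)))
        (cNormR R₀ H₀ 𝔭.blkPX hG.lenle (β - 1)) ((𝔭.ΦX U β ∘ₗ Dd U ν ∘ₗ 𝔬.G0 U) ∘ₗ 𝔬.Dv U)
        (fun a a' => BdX β * Real.exp (-(δ₃ * (geo9Y x).dist a a'))) := by
  letI : Fintype (geo9K x.toKIdx).Site := (inferInstance : Fintype (geo9Y x).Site)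
  exact pXdDH_smooth_of_thm33G0Dir x.toKIdx (trBasis N) (bg9Y (Matrix (Fin N) (Fin N) ℂ) (specialUnitaryUnits (Fin N)) x) (fun U => U) hβ1 hbI0
    (cfg_norm_le_one_of_reg335 x hU) hϑ hΘ (fun _ _ h => dist_sIK_le_of_nearY x.toKIdx hβ1 h) h1p hG hrow hF h33 hbHX1 hDv hDds hBi2 hc hδJ hδ₃
    hδ₃0 hδ₃J hBdX

/-- ★★ **THE SAME OVER THE CLASS-PARAMETRIC CARRIER `bg9YR (M_N ℂ) SU(N) R₁ R₂ x`** (road (α1); `(hG : MemOfFam SU(N) R₁)`, premise `(bg9YR …).Reg335 c α₀ U`).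
[cite: Balaban1985BackgroundPropagators, Thm 3.3 (3.45) p.398 + (3.35)–(3.36) p.396 + (3.43) p.398 + (3.3) p.390 + pp.421–423; Balaban1984PropagatorsII, (2.2) p.224 + (2.51)–(2.56) pp.232–233 + Lemma 2.1 (2.60)–(2.61) p.234] -/
theorem pXdDH_pinsR_smoothGauge {R₁ R₂ : RegFamY d ℓ hd hL b₀ b₁ Mstar (Matrix (Fin N) (Fin N) ℂ)}
    (hGm : MemOfFam (specialUnitaryUnits (Fin N)) R₁) (x : MemberY d ℓ hd hL b₀ b₁ Mstar) {bI : FBondY x.toKIdx → IBondY x.toKIdx}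
    (hβ1 : ∀ f : FBondY x.toKIdx, (geomT x.D).dist (B6Ineq2142KLevelV1.β x.hN x.D x.hk (bI f)) (blkV1 x.hN x.D f) ≤ 1)
    (hbI0 : ∀ f : FBondY x.toKIdx, bI f = bI ⟨f.src, 0⟩) {c35 α₀ : ℝ}
    {U : (bg9YR (Matrix (Fin N) (Fin N) ℂ) (specialUnitaryUnits (Fin N)) R₁ R₂ x).Cfg}
    (hU : (bg9YR (Matrix (Fin N) (Fin N) ℂ) (specialUnitaryUnits (Fin N)) R₁ R₂ x).Reg335 c35 α₀ U) {ϑ : ℝ} (hϑ : 0 ≤ ϑ)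
    (hΘ : ∀ (μ : Fin (d + 1)) (s s' : Site (PV d ℓ x.toKIdx.m x.toKIdx.K hd hL) 0), Adm x.toKIdx ⟨s, μ⟩ ⟨s', μ⟩ →
      tpar x.toKIdx ⟨s, μ⟩ ⟨s', μ⟩ ^ (-(1 : ℝ)) * ‖(U μ s : Matrix (Fin N) (Fin N) ℂ) - (U μ s' : Matrix (Fin N) (Fin N) ℂ)‖ ≤ ϑ)
    {p : ℝ} (h1p : 1 ≤ p)
    {R₀ : ℝ} {H₀ : Prop} (hG : GeoOK (geo9Y x)) {σ c : ℝ} (hrow : RowSum (toB6 (geo9Y x) R₀ H₀) σ c)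
    {dF : ℕ} {δF α L₀ : ℝ} (hF : Facts347 (geo9Y x) R₀ H₀ dF δF α L₀) {Z PX PY : Type} [Fintype PX] [Fintype PY]
    {𝔬 : Ops (geo9Y x) (bg9YR (Matrix (Fin N) (Fin N) ℂ) (specialUnitaryUnits (Fin N)) R₁ R₂ x) (XBK (TrIdx N) x.toKIdx) (XBK (TrIdx N) x.toKIdx) Z
      (XSK (TrIdx N) x.toKIdx)}
    {𝔭 : HolderProbes (geo9Y x) (bg9YR (Matrix (Fin N) (Fin N) ℂ) (specialUnitaryUnits (Fin N)) R₁ R₂ x) (XBK (TrIdx N) x.toKIdx)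
      (XBK (TrIdx N) x.toKIdx) PX PY}
    {Dd Dds : (bg9YR (Matrix (Fin N) (Fin N) ℂ) (specialUnitaryUnits (Fin N)) R₁ R₂ x).Cfg → Fin (d + 1) →
      Module.End ℝ (XBK (TrIdx N) x.toKIdx → ℝ)}
    {bHX : ℝ → BlockNorm (toB6 (geo9Y x) R₀ H₀) (XBK (TrIdx N) x.toKIdx → ℝ)} {B₀ δ₀ : ℝ} {Bh Bi : ℝ → ℝ} {Bi2 : ℝ → ℝ → ℝ}
    (h33 : Thm33G0Dir 𝔬 𝔭 Dd Dds R₀ H₀ bHX B₀ Bh Bi Bi2 δ₀ U)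
    (hbHX1 : bHX 1 = (letI : Fintype (geo9K x.toKIdx).Site := (inferInstance : Fintype (geo9Y x).Site)
      bHZK (κ := TrIdx N) x.toKIdx (R := R₀) (H := H₀) (zero_le_one : (0 : ℝ) ≤ 1) le_rfl h1p))
    (hDv : 𝔬.Dv U = DvcoKH x.toKIdx (trBasis N) (bg9YR (Matrix (Fin N) (Fin N) ℂ) (specialUnitaryUnits (Fin N)) R₁ R₂ x) (fun U => U) U)
    (hDds : Dds U = fun μ => coordOpK (trBasis N) (fun _ : Fin (d + 1) => cdsBₗ x.toKIdx U μ))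
    {δJ δ₃ : ℝ} {BdX : ℝ → ℝ}
    (hBi2 : ∀ e b', 0 < e → e ≤ 1 → 0 ≤ b' → b' < 1 → 0 ≤ Bi2 e b') (hc : 0 ≤ c) (hδJ : 0 ≤ δJ)
    (hδ₃ : 0 ≤ δ₃) (hδ₃0 : δ₃ ≤ δ₀ - α * δF) (hδ₃J : δ₃ + σ ≤ δJ - α * δF)
    (hBdX : ∀ β, 0 ≤ β → β < 1 →
      ((d : ℝ) + 1) * ((1 + CLip d ℓ) * (Bi2 (1 - β) β * L₀) * ((cR39 (trBasis N) * CJZ ℓ p ϑ * Real.exp (δJ * rZ d ℓ (rNear d ℓ + 1))) * L₀) * c) ≤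
        BdX β) :
    letI : Fintype (geo9K x.toKIdx).Site := (inferInstance : Fintype (geo9Y x).Site)
    ∀ (ν : Fin (d + 1)) (β : ℝ), 0 ≤ β → β < 1 →
      HasMaj (weightNorm (bHZ (κ := TrIdx N) x.toKIdx (R := R₀) (H := H₀) (zero_le_one : (0 : ℝ) ≤ 1) le_rfl h1p)
          (fun y => ((geo9Y x).len y)⁻¹) (fun y => inv_nonneg.mpr (hG.lenle y)))
        (cNormR R₀ H₀ 𝔭.blkPX hG.lenle (β - 1)) ((𝔭.ΦX U β ∘ₗ Dd U ν ∘ₗ 𝔬.G0 U) ∘ₗ 𝔬.Dv U)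
        (fun a a' => BdX β * Real.exp (-(δ₃ * (geo9Y x).dist a a'))) := by
  letI : Fintype (geo9K x.toKIdx).Site := (inferInstance : Fintype (geo9Y x).Site)
  exact pXdDH_smooth_of_thm33G0Dir x.toKIdx (trBasis N) (bg9YR (Matrix (Fin N) (Fin N) ℂ) (specialUnitaryUnits (Fin N)) R₁ R₂ x) (fun U => U) hβ1 hbI0
    (fun ν s => specialUnitaryUnits_le_U1 (mem_of_reg335R hGm x hU ν s)) hϑ hΘ (fun _ _ h => dist_sIK_le_of_nearY x.toKIdx hβ1 h) h1p hG hrow hF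
    h33 hbHX1 hDv hDds hBi2 hc hδJ hδ₃ hδ₃0 hδ₃J hBdX

end Literature.MathematicalPhysics.QuantumFieldTheory.Balaban1983to89.B9Thm33G0DirXHolderAtPinsSmoothMembers

end
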